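import Summits.AtomisticToContinuum.HydrodynamicLimit.Theorems.StiffCollisionalRelaxationAprioriBoundsFibreDefsR4
import Summits.AtomisticToContinuum.HydrodynamicLimit.Theorems.StiffCollisionalRelaxationAprioriBoundsFibreDeficitSliceGibbs
import Summits.AtomisticToContinuum.HydrodynamicLimit.Theorems.StiffCollisionalRelaxationAprioriBoundsFibreBracketVanishA
import Summits.AtomisticToContinuum.HydrodynamicLimit.Theorems.StiffCollisionalRelaxationAprioriBoundsFibreBracketVanishB
import Summits.AtomisticToContinuum.HydrodynamicLimit.Theorems.PolynomialCompression.Negative.Everywhere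
import Summits.AtomisticToContinuum.HydrodynamicLimit.Theorems.StiffCollisionalRelaxationAprioriBoundsEntropyRange
import Literature.Analysis.FluidPDE.FractionalNSPrescribedEnergyIterationLimit
import HarnessLib

/-!
# Rate-free statics + exact isentropy: the bracket of the line's identity is `o(N)` in `L¹(0,t)`
(stub `stub_bracketVanish` of the line `fibre-deficit-transfer`, crux `AprioriBounds`, stmt-AtomisticToContinuum-14827, skeleton r4)

Support file (`--supports stmt-AtomisticToContinuum-14827`) of the lead prover of the line, proving the REGISTERED stub
`stub_bracketVanish` verbatim: under the crux prefix, `BracketIntegratedVanishAt σ a₀ θ₀ u₀ ρ θ u t`, i.e.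
`(N+1)⁻¹ ∫₀ᵗ |log Z_N(Λ_s) − S(μ₀) − (N+1)m_s| ds → 0`.

The mathematics is closed-form.  With `κ = 5/2 + (3/2) log 2π`, `g_σ(r) = f_ex(rσ³) + ψ_σ(r)`, `ψ_σ(r) = rσ³f_ex'(rσ³)` and the
thermodynamic entropy `𝒮_s = ∫ ρ_s((3/2)log θ_s − log ρ_s − f_ex(ρ_sσ³))`:
* the slice activity of the tilted reference is `e^κ · ρ_s e^{g_σ(ρ_s)}` (`bv_exp_lam0_eq`), so `Z_N(Λ_s) = e^{κ(N+1)} Z_N(ρ_s e^{g_σ(ρ_s)})`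
  (`tiltZ_eq_ofReal` of part 1 of the lever + activity scaling), and `(N+1)⁻¹ log Z_N(ρ_s e^{g_σ(ρ_s)}) → ∫ρ_sψ_σ(ρ_s)` UNIFORMLY on `[0,t]`
  (file A, `slab_uniform_lda`, from the landed `hardSphereLDA_proof` (B));
* `(N+1)⁻¹ S(μ₀) → 𝒮₀ + 3/2 + (3/2)log 2π` (file B, `tendsto_entropy_timeZero`, from `hardSphereLDA_proof` (A)/(B), the tree's LLN and data
  pinning, through `gibbsEntropy_eq`);
* `m_s = −𝒮_s + ∫ρ_s + ∫ρ_sψ_σ(ρ_s)` (`bv_tiltMean_eq`), `∫ρ_s = 1` (mass conservation + the `t = 0` tie,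
  `PolynomialCompressionEverywhere.integral_density_eq_one`) and `𝒮_s = 𝒮₀` (EXACT ISENTROPY of the classical solution in the dilute
  chamber, `JaynesSqueezeSqueeze.integral_density_mul_hsEnt_eq` after `AdiabatCeiling.exists_chamber_extension` / `restrict`).
Hence `(N+1)⁻¹·bracket_s = [(N+1)⁻¹ log Z_N(ρ_s e^{g}) − ∫ρ_sψ] − [(N+1)⁻¹S(μ₀) − 𝒮₀ − 3/2 − (3/2)log 2π]` EXACTLY (the constants
`κ − 1 = 3/2 + (3/2)log 2π` cancel), both brackets tend to `0`, the first uniformly in `s ≤ t`, so the time integral is `≤ 2δt`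
eventually — no measurability or domination in `s` is needed.
-/

noncomputable section

open MeasureTheory Filter Set Topology
open scoped ENNReal

namespace Summit.AtomisticToContinuum.HydrodynamicLimit.Theorems.FibreDeficitTransfer

open Literature.MathematicalPhysics.KineticTheory Literature.Analysis.FluidPDE
open Literature.Analysis.FunctionSpaces
open Summit.AtomisticToContinuum.HydrodynamicLimit.Theorems.AprioriBoundsNegative (PartOneAt PartTwoAt)
open Summit.AtomisticToContinuum.HydrodynamicLimit.Theorems.VisitLedgerUpscattering (Cfg Flow Flows NiceProfiles)
open MacroClosureLine.StubLedger JaynesSqueezeSqueeze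

/-! ## Slice algebra -/

/-- **The slice activity is `e^κ` times the LDA activity**: `exp(λ₀ + |u|²/(2θ))·(2πθ)^{3/2} = e^{5/2 + (3/2)log 2π} · ρ e^{g_σ(ρ)}`
(`ρ, θ > 0`; the temperature cancels). -/
theorem bv_exp_lam0_eq {σ r ϑ : ℝ} (v : V3) (hr : 0 < r) (hϑ : 0 < ϑ) :
    Real.exp (lam0 σ r ϑ v + ‖v‖ ^ 2 / (2 * ϑ)) * (2 * Real.pi * ϑ) ^ ((3 : ℝ) / 2) =
      Real.exp (5 / 2 + 3 / 2 * Real.log (2 * Real.pi)) *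
        (r * Real.exp (hsExcessFreeEnergy (r * σ ^ 3) + r * σ ^ 3 * deriv hsExcessFreeEnergy (r * σ ^ 3))) := by
  have h2π : 0 < 2 * Real.pi := by positivity
  have h2πθ : 0 < 2 * Real.pi * ϑ := mul_pos h2π hϑ
  rw [Real.rpow_def_of_pos h2πθ, ← Real.exp_add,
    show r * Real.exp (hsExcessFreeEnergy (r * σ ^ 3) + r * σ ^ 3 * deriv hsExcessFreeEnergy (r * σ ^ 3)) =
      Real.exp (Real.log r + (hsExcessFreeEnergy (r * σ ^ 3) + r * σ ^ 3 * deriv hsExcessFreeEnergy (r * σ ^ 3))) by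
      rw [Real.exp_add (Real.log r), Real.exp_log hr], ← Real.exp_add]
  congr 1
  rw [lam0, Real.log_mul h2π.ne' hϑ.ne']
  ring

/-- The density multiplier `λ₀` along continuous positive slice fields in the chamber `ρσ³ < η₀` (where `f_ex`, `f_ex'` are
continuous) is continuous. -/
theorem bv_continuous_lam0_slice {σ η₀ : ℝ} {r ϑ : T3 → ℝ} {v : T3 → V3} (hσ : 0 < σ)
    (hfc : ContinuousOn hsExcessFreeEnergy (Ioo 0 η₀)) (hdfc : ContinuousOn (deriv hsExcessFreeEnergy) (Ioo 0 η₀))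
    (hr : Continuous r) (hϑ : Continuous ϑ) (hv : Continuous v) (hr0 : ∀ x, 0 < r x) (hϑ0 : ∀ x, 0 < ϑ x)
    (hch : ∀ x, r x * σ ^ 3 < η₀) : Continuous fun x => lam0 σ (r x) (ϑ x) (v x) := by
  have hmem : ∀ x, r x * σ ^ 3 ∈ Ioo 0 η₀ := fun x => ⟨mul_pos (hr0 x) (pow_pos hσ 3), hch x⟩
  have hη : Continuous fun x => r x * σ ^ 3 := hr.mul continuous_const
  unfold lam0
  refine ((((((hr.log fun x => (hr0 x).ne').sub (continuous_const.mul (hϑ.log fun x => (hϑ0 x).ne'))).sub ?_).add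
    continuous_const).add (hfc.comp_continuous hη hmem)).add (hη.mul (hdfc.comp_continuous hη hmem)))
  exact (hv.norm.pow 2).div (continuous_const.mul hϑ) fun x => mul_ne_zero two_ne_zero (hϑ0 x).ne'

/-- **The Euler mean of the tilt, decomposed**: `m_s = −𝒮_s + ∫ρ_s + ∫ρ_s ψ_σ(ρ_s)` for continuous positive slice fields in the
chamber. -/
theorem bv_tiltMean_eq {σ η₀ s : ℝ} {ρ θ : ℝ → T3 → ℝ} {u : ℝ → T3 → V3} (hσ : 0 < σ)
    (hfc : ContinuousOn hsExcessFreeEnergy (Ioo 0 η₀)) (hdfc : ContinuousOn (deriv hsExcessFreeEnergy) (Ioo 0 η₀))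
    (hρs : Continuous (ρ s)) (hθs : Continuous (θ s)) (hρ : ∀ x, 0 < ρ s x) (hθ : ∀ x, 0 < θ s x)
    (hch : ∀ x, ρ s x * σ ^ 3 < η₀) :
    tiltMean σ ρ θ u s =
      -(∫ x, ρ s x * (3 / 2 * Real.log (θ s x) - Real.log (ρ s x) - hsExcessFreeEnergy (ρ s x * σ ^ 3))) +
        (∫ x, ρ s x) + ∫ x, ρ s x * (ρ s x * σ ^ 3 * deriv hsExcessFreeEnergy (ρ s x * σ ^ 3)) := by
  have hmem : ∀ x, ρ s x * σ ^ 3 ∈ Ioo 0 η₀ := fun x => ⟨mul_pos (hρ x) (pow_pos hσ 3), hch x⟩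
  have hη : Continuous fun x => ρ s x * σ ^ 3 := hρs.mul continuous_const
  have hf : Continuous fun x => hsExcessFreeEnergy (ρ s x * σ ^ 3) := hfc.comp_continuous hη hmem
  have hdf : Continuous fun x => deriv hsExcessFreeEnergy (ρ s x * σ ^ 3) := hdfc.comp_continuous hη hmem
  have h1 : Integrable (fun x => ρ s x * (3 / 2 * Real.log (θ s x) - Real.log (ρ s x) - hsExcessFreeEnergy (ρ s x * σ ^ 3))) :=
    integrable_of_continuous_T3 (hρs.mul (((continuous_const.mul (hθs.log fun x => (hθ x).ne')).sub
      (hρs.log fun x => (hρ x).ne')).sub hf))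
  have h2 : Integrable (ρ s) := integrable_of_continuous_T3 hρs
  have h3 : Integrable (fun x => ρ s x * (ρ s x * σ ^ 3 * deriv hsExcessFreeEnergy (ρ s x * σ ^ 3))) :=
    integrable_of_continuous_T3 (hρs.mul (hη.mul hdf))
  have hpt : ∀ x, ρ s x * (lam0 σ (ρ s x) (θ s x) (u s x) + ‖u s x‖ ^ 2 / (2 * θ s x) - 3 / 2) =
      -(ρ s x * (3 / 2 * Real.log (θ s x) - Real.log (ρ s x) - hsExcessFreeEnergy (ρ s x * σ ^ 3))) + ρ s x +
        ρ s x * (ρ s x * σ ^ 3 * deriv hsExcessFreeEnergy (ρ s x * σ ^ 3)) := by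
    intro x; rw [lam0]; ring
  have h1' : Integrable (fun x => -(ρ s x * (3 / 2 * Real.log (θ s x) - Real.log (ρ s x) -
      hsExcessFreeEnergy (ρ s x * σ ^ 3)))) := h1.neg
  have h12 : Integrable (fun x => -(ρ s x * (3 / 2 * Real.log (θ s x) - Real.log (ρ s x) -
      hsExcessFreeEnergy (ρ s x * σ ^ 3))) + ρ s x) := h1'.add h2
  rw [tiltMean]
  simp_rw [hpt]
  rw [integral_add h12 h3, integral_add h1' h2, integral_neg]

/-! ## The stub -/

/-- **STUB 3 `bracketVanish` of skeleton r4** (registered; rate-free statics + isentropy).  Under the crux prefix: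
`BracketIntegratedVanishAt σ a₀ θ₀ u₀ ρ θ u t` — `(N+1)⁻¹ ∫₀ᵗ |log Z_N(Λ_s) − S(μ₀) − (N+1)m_s| ds → 0`.  Thresholds: `σ₀` from the
time-zero entropy limit (file B; `≤ 1/2`), `η₁ := min η_A η₀` (the uniform-LDA chamber of file A and the `HsEosLowDensity` chamber). -/
theorem stub_bracketVanish : ∀ (a₀ θ₀ : T3 → ℝ) (u₀ : T3 → V3), Continuous a₀ → Continuous θ₀ → Continuous u₀ → (∀ x, 0 < a₀ x) → (∀ x, 0 < θ₀ x) → ∃ σ₀ : ℝ, 0 < σ₀ ∧ ∃ η₁ : ℝ, 0 < η₁ ∧ ∀ σ : ℝ, 0 < σ → σ < σ₀ → ∀ (T : ℝ) (ρ θ : ℝ → T3 → ℝ) (u : ℝ → T3 → V3), IsHardSphereEulerSolution σ T ρ u θ → ∀ Φ : (N : ℕ) → HardSphereFlow (Torus.geometry (Fin 3)) (hsDiameter σ N) (N + 1), TendstoHydroFieldsAt (fun N => localGibbsLaw σ a₀ u₀ θ₀ N (Φ N)) Φ ρ u θ 0 → ∀ t : ℝ, 0 < t → t < T → (∀ s ∈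 Icc 0 t, ∀ x, 2 * ρ s x * σ ^ 3 < η₁) → BracketIntegratedVanishAt σ a₀ θ₀ u₀ ρ θ u t := by
  intro a₀ θ₀ u₀ ha hθ hu ha0 hθ0
  obtain ⟨ηA, hηA, hUnif⟩ := slab_uniform_lda
  obtain ⟨σ₁, hσ₁, hσ₁2, hEnt⟩ := tendsto_entropy_timeZero a₀ θ₀ u₀ ha hθ hu ha0 hθ0
  obtain ⟨η₀, hη₀, F, hF, hEq, -, -, -⟩ := hsEosLowDensity_proof
  obtain ⟨hfc, hdfc⟩ := bv_eos_continuousOn hF hEq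
  refine ⟨σ₁, hσ₁, min ηA η₀, lt_min hηA hη₀, ?_⟩
  intro σ hσ hσ1 T ρ θ u hE Φ hLLN t ht htT hdil
  have hσ2 : σ ≤ 1 / 2 := (hσ1.trans_le hσ₁2).le
  have hσ3 : 0 < σ ^ 3 := pow_pos hσ 3
  have htT' : t ∈ Ico 0 T := ⟨ht.le, htT⟩
  have hIco : ∀ s ∈ Icc 0 t, s ∈ Ico 0 T := fun s hs => ⟨hs.1, hs.2.trans_lt htT⟩
  have h0t : (0 : ℝ) ∈ Icc 0 t := ⟨le_rfl, ht.le⟩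
  -- the classical solution on the slab: positivity, continuity, chamber, mass, isentropy
  have hρpos : ∀ s ∈ Icc 0 t, ∀ x, 0 < ρ s x := fun s hs x => hE.density_pos s (hIco s hs) x
  have hθpos : ∀ s ∈ Icc 0 t, ∀ x, 0 < θ s x := fun s hs x => hE.temperature_pos s (hIco s hs) x
  have hρsc : ∀ s ∈ Icc 0 t, Continuous (ρ s) := fun s hs => (hE.smooth_density.isSmooth_slice (hIco s hs)).continuous
  have hθsc : ∀ s ∈ Icc 0 t, Continuous (θ s) := fun s hs => (hE.smooth_temperature.isSmooth_slice (hIco s hs)).continuous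
  have husc : ∀ s ∈ Icc 0 t, Continuous (u s) := fun s hs => (hE.smooth_velocity.isSmooth_slice (hIco s hs)).continuous
  have hρc : ContinuousOn (Function.uncurry ρ) (Icc 0 t ×ˢ univ) :=
    (Torus.continuousOn_uncurry_of_continuousOn_stLift hE.smooth_density.continuousOn_stLift).mono
      (prod_mono (fun s hs => hIco s hs) subset_rfl)
  have hchA : ∀ s ∈ Icc 0 t, ∀ x, ρ s x * σ ^ 3 < ηA := fun s hs x => by
    have h := hdil s hs x
    have h0 : 0 < ρ s x * σ ^ 3 := mul_pos (hρpos s hs x) hσ3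
    linarith [min_le_left ηA η₀]
  have hch₀ : ∀ s ∈ Icc 0 t, ∀ x, ρ s x * σ ^ 3 < η₀ := fun s hs x => by
    have h := hdil s hs x
    have h0 : 0 < ρ s x * σ ^ 3 := mul_pos (hρpos s hs x) hσ3
    linarith [min_le_right ηA η₀]
  obtain ⟨cρ, hcρ, hcρle⟩ :=
    JaynesSqueezeSqueeze.exists_pos_le_of_isSmoothSpaceTimeOn hE.smooth_density hE.density_pos htT'
  have hmass : ∀ s ∈ Icc 0 t, ∫ x, ρ s x = 1 := fun s hs =>
    PolynomialCompressionEverywhere.integral_density_eq_one hσ2 ha hθ hu ha0 hθ0 hE Φ hLLN (hIco s hs)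
  set S₀ : ℝ := ∫ x, ρ 0 x * (3 / 2 * Real.log (θ 0 x) - Real.log (ρ 0 x) - hsExcessFreeEnergy (ρ 0 x * σ ^ 3)) with hS₀
  have hSs : ∀ s ∈ Icc 0 t, ∫ x, ρ s x * (3 / 2 * Real.log (θ s x) - Real.log (ρ s x) -
      hsExcessFreeEnergy (ρ s x * σ ^ 3)) = S₀ := by
    intro s hs
    obtain ⟨t', htt', ht'T, hch'⟩ := AdiabatCeiling.exists_chamber_extension hE hσ ht.le htT hch₀
    exact integral_density_mul_hsEnt_eq hη₀ hF hEq hσ (hE.restrict ht'T) hch' ⟨hs.1, hs.2.trans_lt htt'⟩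
  -- the equation-of-state functions at this `σ`
  set g : ℝ → ℝ := fun r => hsExcessFreeEnergy (r * σ ^ 3) + r * σ ^ 3 * deriv hsExcessFreeEnergy (r * σ ^ 3) with hg
  set ψ : ℝ → ℝ := fun r => r * σ ^ 3 * deriv hsExcessFreeEnergy (r * σ ^ 3) with hψ
  have hψr : ∀ r, r * σ ^ 3 * deriv hsExcessFreeEnergy (r * σ ^ 3) = ψ r := fun r => rfl
  have hgψr : ∀ r, hsExcessFreeEnergy (r * σ ^ 3) + ψ r = g r := fun r => rfl
  have hJ : ∀ r ∈ Ioo (0 : ℝ) (η₀ / σ ^ 3), r * σ ^ 3 ∈ Ioo 0 η₀ := fun r hr =>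
    ⟨mul_pos hr.1 hσ3, (lt_div_iff₀ hσ3).1 hr.2⟩
  have hlin : ContinuousOn (fun r : ℝ => r * σ ^ 3) (Ioo 0 (η₀ / σ ^ 3)) := continuousOn_id.mul continuousOn_const
  have hgc : ContinuousOn g (Ioo 0 (η₀ / σ ^ 3)) := (hfc.comp hlin hJ).add (hlin.mul (hdfc.comp hlin hJ))
  have hρJ : ∀ s ∈ Icc 0 t, ∀ x, ρ s x ∈ Ioo (0 : ℝ) (η₀ / σ ^ 3) := fun s hs x =>
    ⟨hρpos s hs x, (lt_div_iff₀ hσ3).2 (hch₀ s hs x)⟩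
  -- (1) the time-zero entropy
  set Slim : ℝ := S₀ + 3 / 2 + 3 / 2 * Real.log (2 * Real.pi) with hSlim
  have hS : Tendsto (fun N : ℕ => ((N : ℝ) + 1)⁻¹ * gibbsEntropy σ a₀ u₀ θ₀ N) atTop (𝓝 Slim) := by
    have h := hEnt σ hσ hσ1 ρ θ u (hρsc 0 h0t) (hθsc 0 h0t) (husc 0 h0t) Φ hLLN
    refine h.congr fun N => ?_
    have hN : ((N : ℝ) + 1) ≠ 0 := by positivity
    rw [gibbsEntropy_eq ha hθ hu ha0 hθ0 hσ2 N (Φ N), mul_sub, ← mul_assoc, inv_mul_cancel₀ hN, one_mul]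
  -- (2) the uniform local density approximation on the slab
  have hslices : ∀ s ∈ Icc 0 t, Continuous (θ s) ∧ Continuous (u s) ∧ ∀ x, 0 < θ s x := fun s hs =>
    ⟨hθsc s hs, husc s hs, hθpos s hs⟩
  have hchA' : ∀ s ∈ Icc 0 t, ∀ x, cρ ≤ ρ s x ∧ ρ s x * σ ^ 3 < ηA := fun s hs x => ⟨hcρle s hs x, hchA s hs x⟩
  have hU := hUnif σ t cρ ρ θ u Φ hσ hσ2 ht.le hcρ hρc hslices hchA' hmass
  simp only [hψr, hgψr] at hU
  -- (3) the exact pointwise identity on the slab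
  set κ : ℝ := 5 / 2 + 3 / 2 * Real.log (2 * Real.pi) with hκ
  have hident : ∀ (N : ℕ), ∀ s ∈ Icc 0 t,
      ((N : ℝ) + 1)⁻¹ * |Real.log (tiltZ σ ρ θ u N s).toReal - gibbsEntropy σ a₀ u₀ θ₀ N - ((N : ℝ) + 1) * tiltMean σ ρ θ u s| =
      |(((N : ℝ) + 1)⁻¹ * Real.log (canonicalPartition (Torus.geometry (Fin 3)) (hsDiameter σ N) (N + 1)
          (localGibbsProfile (fun x => ρ s x * Real.exp (g (ρ s x))) (u s) (θ s))) - ∫ x, ρ s x * ψ (ρ s x)) -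
        (((N : ℝ) + 1)⁻¹ * gibbsEntropy σ a₀ u₀ θ₀ N - Slim)| := by
    intro N s hs
    have hN : (0 : ℝ) < (N : ℝ) + 1 := by positivity
    have hρs := hρsc s hs
    obtain ⟨hθs, hus, hθp⟩ := hslices s hs
    have hρp := hρpos s hs
    have hΛs : Continuous fun x => lam0 σ (ρ s x) (θ s x) (u s x) :=
      bv_continuous_lam0_slice hσ hfc hdfc hρs hθs hus hρp hθp (hch₀ s hs)
    -- the activity of the slice and its partition function
    have hbc : Continuous fun x => ρ s x * Real.exp (g (ρ s x)) :=
      hρs.mul ((hgc.comp_continuous hρs (hρJ s hs)).rexp)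
    have hbp : ∀ x, 0 < ρ s x * Real.exp (g (ρ s x)) := fun x => mul_pos (hρp x) (Real.exp_pos _)
    have hZb : 0 < canonicalPartition (Torus.geometry (Fin 3)) (hsDiameter σ N) (N + 1)
        (localGibbsProfile (fun x => ρ s x * Real.exp (g (ρ s x))) (u s) (θ s)) :=
      canonicalPartition_localGibbs_pos hσ2 N hbc hθs hus hbp hθp
    have hact : (fun x => Real.exp (lam0 σ (ρ s x) (θ s x) (u s x) + ‖u s x‖ ^ 2 / (2 * θ s x)) *
        (2 * Real.pi * θ s x) ^ ((3 : ℝ) / 2)) = fun x => Real.exp κ * (ρ s x * Real.exp (g (ρ s x))) := by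
      funext x
      rw [bv_exp_lam0_eq (u s x) (hρp x) (hθp x)]
    have hZt : (tiltZ σ ρ θ u N s).toReal = Real.exp κ ^ (N + 1) * canonicalPartition (Torus.geometry (Fin 3)) (hsDiameter σ N)
        (N + 1) (localGibbsProfile (fun x => ρ s x * Real.exp (g (ρ s x))) (u s) (θ s)) := by
      rw [tiltZ_eq_ofReal s hθs hus hθp hΛs N, hact, localGibbsProfile_const_mul, canonicalPartition_const_mul,
        ENNReal.toReal_ofReal (mul_nonneg (pow_nonneg (Real.exp_pos κ).le _) hZb.le)]
    have hlogZ : Real.log (tiltZ σ ρ θ u N s).toReal = ((N : ℝ) + 1) * κ + Real.log (canonicalPartition (Torus.geometry (Fin 3))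
        (hsDiameter σ N) (N + 1) (localGibbsProfile (fun x => ρ s x * Real.exp (g (ρ s x))) (u s) (θ s))) := by
      rw [hZt, Real.log_mul (pow_pos (Real.exp_pos κ) _).ne' hZb.ne', Real.log_pow, Real.log_exp]
      push_cast
      ring
    -- the Euler mean
    have hm : tiltMean σ ρ θ u s = -S₀ + 1 + ∫ x, ρ s x * ψ (ρ s x) := by
      rw [bv_tiltMean_eq hσ hfc hdfc hρs hθs hρp hθp (hch₀ s hs), hSs s hs, hmass s hs]
    rw [← abs_of_pos (inv_pos.2 hN), ← abs_mul, abs_of_pos (inv_pos.2 hN), hlogZ, hm]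
    congr 1
    simp only [hSlim, hκ]
    field_simp
    ring
  -- (4) assembly: the time integral is eventually `≤ 2δt`
  rw [BracketIntegratedVanishAt, ENNReal.tendsto_nhds_zero]
  intro ε hε
  rcases eq_top_or_lt_top ε with hεtop | hεlt
  · exact Eventually.of_forall fun N => hεtop ▸ le_top
  have hε' : 0 < ε.toReal := ENNReal.toReal_pos hε.ne' hεlt.ne
  set δ : ℝ := ε.toReal / (2 * t) with hδ
  have hδ0 : 0 < δ := by positivity
  have h1 := hU δ hδ0
  have h2 : ∀ᶠ N : ℕ in atTop, |((N : ℝ) + 1)⁻¹ * gibbsEntropy σ a₀ u₀ θ₀ N - Slim| ≤ δ := by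
    have h := (Metric.tendsto_nhds.1 hS) δ hδ0
    exact h.mono fun N hN => by rw [Real.dist_eq] at hN; exact hN.le
  filter_upwards [h1, h2] with N hN1 hN2
  calc ∫⁻ s in Icc 0 t, ENNReal.ofReal (((N : ℝ) + 1)⁻¹ *
        |Real.log (tiltZ σ ρ θ u N s).toReal - gibbsEntropy σ a₀ u₀ θ₀ N - ((N : ℝ) + 1) * tiltMean σ ρ θ u s|)
      ≤ ∫⁻ _ in Icc 0 t, ENNReal.ofReal (δ + δ) := by
        refine setLIntegral_mono' measurableSet_Icc fun s hs => ENNReal.ofReal_le_ofReal ?_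
        rw [hident N s hs]
        exact (abs_sub _ _).trans (add_le_add (hN1 s hs) hN2)
    _ = ENNReal.ofReal (δ + δ) * volume (Icc (0 : ℝ) t) := setLIntegral_const _ _
    _ = ε := by
        rw [Real.volume_Icc, sub_zero, ← ENNReal.ofReal_mul (by positivity), ← ENNReal.ofReal_toReal hεlt.ne]
        congr 1
        rw [hδ]
        field_simp
        ring

end Summit.AtomisticToContinuum.HydrodynamicLimit.Theorems.FibreDeficitTransfer

end
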